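import Literature.NumberTheory.LFunctions.SiegelAbelSummation
import Literature.NumberTheory.LFunctions.DirichletLFunctionZeroReflection
import Literature.Barriers.RiemannHypothesis.FeketePolyaPositivityEven
import HarnessLib

/-!
# The one-period truncation of `L(σ, χ)` with a second-order tail bound, and the cell bound in `σ`:
# the analytic half of a kernel certificate for `L(σ, χ) > 0` on `[1/2, 1]` (Davenport–Chua method)

Topic `Literature/NumberTheory/LFunctions`; namespace `Literature.NumberTheory.LFunctions.LTruncation`.
THEOREMS only; no definition, no named fact, no `sorry`.  Cell
`parity-realchar` (kernel floor of the wide column, EVEN characters: the real quadratic fields).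

## Source and what is proved

K. S. Chua, *Real zeros of Dedekind zeta functions of real quadratic fields*, Math. Comp. **74** (2005)
1457–1470, §2: «it suffices for us to show that an exact finite sum `L_t(s, χ) = ∑_{ν ≤ t} S_ν(s, χ)` is
nonnegative … to conclude that `L(s, χ) > 0`»; **Theorem 2.2** (explicit bound for the remainder
`E_{t+1}(s, χ) = L(s, χ) − L_t(s, χ)`, of size `q^{1/2−s}(t+1)^{−s−1}`); **§2.2, Lemma 2.3 / ALGO 1** (from
positivity at a point `s₀` to positivity on an interval `[s₀, s₀ + f(s₀)/g(s₀))`, then the functional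
equation for `s < 1/2`). [cite: Chua2005RealZeros, §2.1 (2.5), Theorem 2.2, §2.2 Lemma 2.3, ALGO 1]

This file proves an elementary variant of that scheme for Mathlib's `DirichletCharacter.LFunction`, in the
form consumed by a kernel certificate checker (companion file `DirichletLTruncationCertificates.lean`):

* `norm_sum_mul_le_of_antitone` — Abel's inequality (bounded partial sums against decreasing weights);
* notation of this docstring: `P(σ) := ∑_{n ≤ q} ℜχ(n) n^{−σ}` (one period; Chua's `L_0(σ, χ)` for real `χ`);
* **`re_LFunction_ge_truncation`** — for `χ ≠ χ₀` mod `q`, real `σ > 0`: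
  `ℜ L(σ, χ) ≥ P(σ) − B · ((q+1)^{−σ} − (q+2)^{−σ})`, where `B` bounds the SECOND partial sums
  `U(N) = ∑_{K ≤ N} S(K)` (`S(K) = ∑_{n ≤ K} χ(n)`) over one period and `U(q) = 0` (automatic for even `χ`;
  checked by computation in the certificates).  Proof: MV Thm 1.3 / 4.8 in the tree's form
  `L(s, χ) = ∑_N S(N)(N^{−s} − (N+1)^{−s})` (`DirichletAbel.LFunction_eq_abelSum`), the head is `P(σ)`
  because `S(q) = 0`, and a second Abel summation bounds the tail since the weights decrease (convexity,
  tree `two_mul_rpow_neg_lt`) and `U` is `q`-periodic;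
* **`cell_bound`** — for real `c_n`, `A(N) = ∑_{n ≤ N} c_n n^{−s₀}` and `0 ≤ u ≤ h`:
  `∑_{n ≤ M} c_n n^{−(s₀+u)} ≥ A(M) M^{−u} − h ∑_{N < M} max(0, −A(N))/N` — positivity of `P` on a cell
  `[s₀, s₀ + h]` from the partial sums AT `s₀` (replaces the derivative bound of Lemma 2.3);
* (private) `wt_le_of_half_le` — `m^{−σ} − (m+1)^{−σ} ≤ 1/(2 r m)` for `σ ≥ 1/2`, `m ≥ 8`, `r² ≤ m`;
* `lfunction_ne_zero_of_re_pos` — `ℜ L(σ, χ) > 0` on `[1/2, 1]` ⇒ `L(σ, χ) ≠ 0` on `(0, 1)` for PRIMITIVE `χ`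
  (reflection of zeros, tree `LFunction_one_sub_conj_eq_zero`, MV §10.1);
* **`lfunction_ne_zero_of_truncation`** — the assembled criterion: `χ` primitive, `q ≥ 7`, `U(q) = 0`,
  `‖U(N)‖ ≤ B`, `r² ≤ q+1`, and `P(σ) > B/(2r(q+1))` on `[1/2, 1]` ⇒ no zero of `L(s, χ)` in `(0, 1)`.

## References

* [Chua2005RealZeros] K. S. Chua, Math. Comp. 74 (2005) 1457–1470, §2 (held:
  `paper:galaxy-pdf-2508890746968746840`, pp. 1–5 read).
* [MontgomeryVaughan2007] H. L. Montgomery, R. C. Vaughan, *Multiplicative Number Theory I*, CUP 2007,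
  §1.3 Thm 1.3, §4.3 Thm 4.8 / (4.23), §10.1, §11.2.1 Exercise 7 (e).
-/

noncomputable section

open Complex Finset Filter Topology

namespace Literature.NumberTheory.LFunctions

namespace LTruncation

/-! ### Elementary inequalities for the weights `m^{-u} − (m+1)^{-u}` -/

/-- For `m ≥ 1` and `u ≥ 0`: `m^{-u} − (m+1)^{-u} ≤ m^{-u} · (u/m)` (from `(1 + 1/m)^{-u} =
exp(−u log(1 + 1/m)) ≥ 1 − u log(1 + 1/m) ≥ 1 − u/m`; the estimate behind MV Thm 1.3). [folklore] -/
private theorem rpow_neg_sub_succ_le {m : ℕ} (hm : 1 ≤ m) {u : ℝ} (hu : 0 ≤ u) :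
    (m : ℝ) ^ (-u) - ((m + 1 : ℕ) : ℝ) ^ (-u) ≤ (m : ℝ) ^ (-u) * (u / m) := by
  have hm0 : (0 : ℝ) < m := by exact_mod_cast hm
  have hm1 : (0 : ℝ) < (m : ℝ) + 1 := by linarith
  have hcast : ((m + 1 : ℕ) : ℝ) = (m : ℝ) + 1 := by push_cast; ring
  rw [hcast]
  -- `(m+1)^{-u} = m^{-u} · ((m+1)/m)^{-u}`
  have hsplit : ((m : ℝ) + 1) ^ (-u) = (m : ℝ) ^ (-u) * (((m : ℝ) + 1) / m) ^ (-u) := by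
    rw [Real.div_rpow hm1.le hm0.le, mul_div_assoc', mul_comm, ← mul_div_assoc', div_self
      (Real.rpow_pos_of_pos hm0 _).ne', mul_one]
  -- `((m+1)/m)^{-u} ≥ 1 − u/m`
  have hlog : Real.log (((m : ℝ) + 1) / m) ≤ 1 / m := by
    have h := Real.log_le_sub_one_of_pos (show (0 : ℝ) < ((m : ℝ) + 1) / m by positivity)
    have h2 : ((m : ℝ) + 1) / m - 1 = 1 / m := by field_simp; ring
    linarith
  have hexp : 1 - u / m ≤ (((m : ℝ) + 1) / m) ^ (-u) := by
    rw [Real.rpow_def_of_pos (by positivity)]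
    have h1 := Real.add_one_le_exp (Real.log (((m : ℝ) + 1) / m) * -u)
    have h2 : -(u / m) ≤ Real.log (((m : ℝ) + 1) / m) * -u := by
      have : Real.log (((m : ℝ) + 1) / m) * u ≤ 1 / m * u := mul_le_mul_of_nonneg_right hlog hu
      have h3 : 1 / (m : ℝ) * u = u / m := by ring
      linarith
    linarith
  have hpos : 0 < (m : ℝ) ^ (-u) := Real.rpow_pos_of_pos hm0 _
  rw [hsplit]
  nlinarith [mul_le_mul_of_nonneg_left hexp hpos.le]

/-- For `m ≥ 1`, `u ≥ 0`: `0 ≤ m^{-u} − (m+1)^{-u} ≤ u/m`. [folklore] -/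
private theorem rpow_neg_sub_succ_le' {m : ℕ} (hm : 1 ≤ m) {u : ℝ} (hu : 0 ≤ u) :
    (m : ℝ) ^ (-u) - ((m + 1 : ℕ) : ℝ) ^ (-u) ≤ u / m := by
  have hm0 : (0 : ℝ) < m := by exact_mod_cast hm
  have h1 := rpow_neg_sub_succ_le hm hu
  have h2 : (m : ℝ) ^ (-u) ≤ 1 :=
    Real.rpow_le_one_of_one_le_of_nonpos (by exact_mod_cast hm) (by linarith)
  have h3 : 0 ≤ u / (m : ℝ) := by positivity
  calc (m : ℝ) ^ (-u) - ((m + 1 : ℕ) : ℝ) ^ (-u) ≤ (m : ℝ) ^ (-u) * (u / m) := h1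
    _ ≤ 1 * (u / m) := mul_le_mul_of_nonneg_right h2 h3
    _ = u / m := one_mul _

/-- For `m ≥ 1`, `u ≥ 0`: `0 ≤ m^{-u} − (m+1)^{-u}`. [folklore] -/
private theorem rpow_neg_sub_succ_nonneg {m : ℕ} (hm : 1 ≤ m) {u : ℝ} (hu : 0 ≤ u) :
    0 ≤ (m : ℝ) ^ (-u) - ((m + 1 : ℕ) : ℝ) ^ (-u) := by
  have hm0 : (0 : ℝ) < m := by exact_mod_cast hm
  rw [sub_nonneg]
  exact Real.rpow_le_rpow_of_nonpos hm0 (by push_cast; linarith) (by linarith)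

/-- The weights `m^{-σ} − (m+1)^{-σ}` decrease in `m` (convexity of `x ↦ x^{-σ}`, tree lemma
`two_mul_rpow_neg_lt`). [cite: MontgomeryVaughan2007, §11.2.1 Exercise 7 (e)] -/
private theorem wt_succ_le {σ : ℝ} (hσ : 0 < σ) (n : ℕ) :
    ((n + 1 + 1 : ℕ) : ℝ) ^ (-σ) - ((n + 1 + 1 + 1 : ℕ) : ℝ) ^ (-σ) ≤
      ((n + 1 : ℕ) : ℝ) ^ (-σ) - ((n + 1 + 1 : ℕ) : ℝ) ^ (-σ) := by
  have h := Literature.Barriers.RiemannHypothesis.two_mul_rpow_neg_lt n hσ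
  linarith

/-- **Tail weight at `σ ≥ 1/2`.** For `m ≥ 8` (so `log m ≥ 2`) and `σ ≥ 1/2`:
`m^{-σ} − (m+1)^{-σ} ≤ 1/(2 m √m)`, in the rational form `≤ 1/(2 r m)` for any `0 < r`, `r² ≤ m` (the size `q^{1/2−s}(t+1)^{−s−1}` of Chua's Theorem 2.2 at `t = 0`). [cite: Chua2005RealZeros, Theorem 2.2] -/
private theorem wt_le_of_half_le {σ : ℝ} (hσ : 1 / 2 ≤ σ) {m : ℕ} (hm : 8 ≤ m) {r : ℕ} (hr : 0 < r)
    (hrm : r * r ≤ m) : (m : ℝ) ^ (-σ) - ((m + 1 : ℕ) : ℝ) ^ (-σ) ≤ 1 / (2 * r * m) := by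
  have hm1 : 1 ≤ m := by omega
  have hm0 : (0 : ℝ) < m := by exact_mod_cast (show 0 < m by omega)
  have hr0 : (0 : ℝ) < r := by exact_mod_cast hr
  -- step 1: `wt σ m ≤ m^{-σ} σ / m`
  have h1 : (m : ℝ) ^ (-σ) - ((m + 1 : ℕ) : ℝ) ^ (-σ) ≤ (m : ℝ) ^ (-σ) * (σ / m) :=
    rpow_neg_sub_succ_le hm1 (by linarith)
  -- step 2: `σ m^{-σ} ≤ (1/2) m^{-1/2}` since `log m ≥ 2`
  have hlog : 2 ≤ Real.log m := by
    have h8 : (8 : ℝ) ≤ m := by exact_mod_cast hm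
    have he : Real.exp 2 ≤ 8 := by
      have := Real.exp_one_lt_d9
      have h2 : Real.exp 2 = Real.exp 1 * Real.exp 1 := by rw [← Real.exp_add]; norm_num
      nlinarith [Real.exp_pos 1]
    calc (2 : ℝ) = Real.log (Real.exp 2) := (Real.log_exp 2).symm
      _ ≤ Real.log m := Real.log_le_log (Real.exp_pos 2) (he.trans h8)
  have h2 : σ * (m : ℝ) ^ (-σ) ≤ 1 / 2 * (m : ℝ) ^ (-(1 / 2 : ℝ)) := by
    -- `m^{-σ} = m^{-1/2} · exp(−(σ − 1/2) log m) ≤ m^{-1/2} exp(−2(σ − 1/2))`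
    have hsplit : (m : ℝ) ^ (-σ) = (m : ℝ) ^ (-(1 / 2 : ℝ)) * Real.exp (-(σ - 1 / 2) * Real.log m) := by
      rw [Real.rpow_def_of_pos hm0, Real.rpow_def_of_pos hm0, ← Real.exp_add]
      congr 1; ring
    have hexp : Real.exp (-(σ - 1 / 2) * Real.log m) ≤ Real.exp (-(σ - 1 / 2) * 2) := by
      rw [Real.exp_le_exp]; nlinarith
    -- `2σ e^{1 − 2σ} ≤ 1`, i.e. `2σ ≤ e^{2σ − 1}`
    have hkey : σ * Real.exp (-(σ - 1 / 2) * 2) ≤ 1 / 2 := by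
      have h3 := Real.add_one_le_exp (2 * σ - 1)
      have h4 : Real.exp (-(σ - 1 / 2) * 2) * Real.exp (2 * σ - 1) = 1 := by
        rw [← Real.exp_add]; norm_num; ring_nf
      have h5 : 0 < Real.exp (-(σ - 1 / 2) * 2) := Real.exp_pos _
      nlinarith
    have hpos : 0 < (m : ℝ) ^ (-(1 / 2 : ℝ)) := Real.rpow_pos_of_pos hm0 _
    rw [hsplit]
    have hσ0 : 0 ≤ σ := by linarith
    calc σ * ((m : ℝ) ^ (-(1 / 2 : ℝ)) * Real.exp (-(σ - 1 / 2) * Real.log m))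
        = (m : ℝ) ^ (-(1 / 2 : ℝ)) * (σ * Real.exp (-(σ - 1 / 2) * Real.log m)) := by ring
      _ ≤ (m : ℝ) ^ (-(1 / 2 : ℝ)) * (σ * Real.exp (-(σ - 1 / 2) * 2)) :=
          mul_le_mul_of_nonneg_left (mul_le_mul_of_nonneg_left hexp hσ0) hpos.le
      _ ≤ (m : ℝ) ^ (-(1 / 2 : ℝ)) * (1 / 2) := mul_le_mul_of_nonneg_left hkey hpos.le
      _ = 1 / 2 * (m : ℝ) ^ (-(1 / 2 : ℝ)) := by ring
  -- step 3: `m^{-1/2} = 1/√m ≤ 1/r`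
  have h3 : (m : ℝ) ^ (-(1 / 2 : ℝ)) ≤ 1 / r := by
    have hsq : (r : ℝ) ≤ Real.sqrt m := by
      rw [Real.le_sqrt hr0.le hm0.le]; exact_mod_cast (by simpa [pow_two] using hrm)
    rw [Real.rpow_neg hm0.le, ← Real.sqrt_eq_rpow, one_div]
    exact inv_anti₀ hr0 hsq
  calc (m : ℝ) ^ (-σ) - ((m + 1 : ℕ) : ℝ) ^ (-σ) ≤ (m : ℝ) ^ (-σ) * (σ / m) := h1
    _ = σ * (m : ℝ) ^ (-σ) / m := by ring
    _ ≤ 1 / 2 * (m : ℝ) ^ (-(1 / 2 : ℝ)) / m := div_le_div_of_nonneg_right h2 hm0.le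
    _ ≤ 1 / 2 * (1 / r) / m :=
        div_le_div_of_nonneg_right (mul_le_mul_of_nonneg_left h3 (by norm_num)) hm0.le
    _ = 1 / (2 * r * m) := by field_simp


/-! ### Abel's inequality: bounded partial sums against decreasing non-negative weights -/

/-- **Abel's inequality.** If every partial sum `∑_{k<N} a_k`, `N ≤ L`, has norm `≤ B`, and the real
weights `w_k ≥ 0` decrease, then `‖∑_{k<L} a_k w_k‖ ≤ B · w_0`. [cite: MontgomeryVaughan2007, §1.3 Thm. 1.3] -/
theorem norm_sum_mul_le_of_antitone (a : ℕ → ℂ) (w : ℕ → ℝ) {B : ℝ} (L : ℕ)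
    (hA : ∀ N, N ≤ L → ‖∑ k ∈ range N, a k‖ ≤ B) (hw0 : ∀ k, 0 ≤ w k)
    (hw : ∀ k, w (k + 1) ≤ w k) :
    ‖∑ k ∈ range L, a k * (w k : ℂ)‖ ≤ B * w 0 := by
  have hB : 0 ≤ B := le_trans (by simp) (hA 0 (Nat.zero_le L))
  rcases Nat.eq_zero_or_pos L with rfl | hL
  · simpa using mul_nonneg hB (hw0 0)
  have hparts := Finset.sum_range_by_parts (fun k ↦ ((w k : ℝ) : ℂ)) a L
  have hcomm : ∑ k ∈ range L, a k * (w k : ℂ) = ∑ k ∈ range L, ((w k : ℝ) : ℂ) • a k :=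
    Finset.sum_congr rfl fun k _ ↦ by rw [smul_eq_mul, mul_comm]
  rw [hcomm, hparts]
  -- telescoping sum of the (non-negative) weight decrements
  have htel : ∑ i ∈ range (L - 1), (w i - w (i + 1)) = w 0 - w (L - 1) :=
    Finset.sum_range_sub' w (L - 1)
  have h1 : ‖((w (L - 1) : ℝ) : ℂ) • ∑ k ∈ range L, a k‖ ≤ w (L - 1) * B := by
    rw [norm_smul, Complex.norm_real, Real.norm_of_nonneg (hw0 _)]
    exact mul_le_mul_of_nonneg_left (hA L le_rfl) (hw0 _)
  have h2 : ‖∑ i ∈ range (L - 1), (((w (i + 1) : ℝ) : ℂ) - ((w i : ℝ) : ℂ)) • ∑ k ∈ range (i + 1), a k‖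
      ≤ ∑ i ∈ range (L - 1), (w i - w (i + 1)) * B := by
    refine (norm_sum_le _ _).trans (Finset.sum_le_sum fun i hi ↦ ?_)
    have hiL : i + 1 ≤ L := by have := Finset.mem_range.mp hi; omega
    rw [norm_smul, ← Complex.ofReal_sub, Complex.norm_real, Real.norm_of_nonpos (by linarith [hw i]),
      neg_sub]
    exact mul_le_mul_of_nonneg_left (hA (i + 1) hiL) (by linarith [hw i])
  calc ‖((w (L - 1) : ℝ) : ℂ) • ∑ k ∈ range L, a k -
        ∑ i ∈ range (L - 1), (((w (i + 1) : ℝ) : ℂ) - ((w i : ℝ) : ℂ)) • ∑ k ∈ range (i + 1), a k‖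
      ≤ w (L - 1) * B + ∑ i ∈ range (L - 1), (w i - w (i + 1)) * B :=
        (norm_sub_le _ _).trans (add_le_add h1 h2)
    _ = B * w 0 := by rw [← Finset.sum_mul, htel]; ring

/-! ### The truncation bound for `L(σ, χ)` -/

open DirichletAbel

variable {q : ℕ} [NeZero q] (χ : DirichletCharacter ℂ q)

omit [NeZero q] in
/-- The Abel terms at a real point: `term χ n σ = S(n+1) · ((n+1)^{-σ} − (n+2)^{-σ})`. [cite: MontgomeryVaughan2007, §1.3 Thm. 1.3] -/
private theorem term_ofReal (n : ℕ) (σ : ℝ) :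
    term χ n (σ : ℂ) = partialSum χ (n + 1) *
      ((((n + 1 : ℕ) : ℝ) ^ (-σ) - ((n + 1 + 1 : ℕ) : ℝ) ^ (-σ) : ℝ) : ℂ) := by
  simp only [term]
  rw [show ((n + 1 : ℕ) : ℂ) = (((n + 1 : ℕ) : ℝ) : ℂ) by push_cast; rfl,
    show ((n + 1 + 1 : ℕ) : ℂ) = (((n + 1 + 1 : ℕ) : ℝ) : ℂ) by push_cast; rfl,
    show -(σ : ℂ) = ((-σ : ℝ) : ℂ) by push_cast; rfl,
    ← Complex.ofReal_cpow (by positivity), ← Complex.ofReal_cpow (by positivity), ← Complex.ofReal_sub]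

/-- Second-order periodicity: if `U(q) := ∑_{K ≤ q} S(K) = 0` then the sums `∑_{k<N} S(k+1)` are
`q`-periodic in `N` (`χ ≠ χ₀`, so `S` itself is `q`-periodic). [cite: MontgomeryVaughan2007, §4.3 eq. (4.23)] -/
theorem sum_partialSum_add_level (hχ : χ ≠ 1) (hUq : ∑ k ∈ range q, partialSum χ (k + 1) = 0)
    (N : ℕ) : ∑ k ∈ range (N + q), partialSum χ (k + 1) = ∑ k ∈ range N, partialSum χ (k + 1) := by
  rw [add_comm N q, Finset.sum_range_add, hUq, zero_add]
  refine Finset.sum_congr rfl fun k _ ↦ ?_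
  rw [show q + k + 1 = (k + 1) + q by ring, partialSum_add_level χ hχ]

/-- Hence a bound over one period is a bound everywhere. [cite: MontgomeryVaughan2007, §4.3 eq. (4.23)] -/
theorem norm_sum_partialSum_le (hχ : χ ≠ 1) (hUq : ∑ k ∈ range q, partialSum χ (k + 1) = 0)
    {B : ℝ} (hU : ∀ N, N < q → ‖∑ k ∈ range N, partialSum χ (k + 1)‖ ≤ B) (N : ℕ) :
    ‖∑ k ∈ range N, partialSum χ (k + 1)‖ ≤ B := by
  induction N using Nat.strong_induction_on with
  | _ N ih =>
    rcases lt_or_ge N q with hN | hN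
    · exact hU N hN
    · obtain ⟨k, rfl⟩ := Nat.exists_eq_add_of_le hN
      rw [add_comm, sum_partialSum_add_level χ hχ hUq]
      exact ih k (by have := NeZero.pos q; omega)

/-- **The tail.** For `χ ≠ χ₀` mod `q` with `∑_{K ≤ q} S(K) = 0` and `‖∑_{K ≤ N} S(K)‖ ≤ B` (`N < q`):
for real `σ > 0`, `‖∑_{n > q} S(n) (n^{-σ} − (n+1)^{-σ})‖ ≤ B · ((q+1)^{-σ} − (q+2)^{-σ})`
(second Abel summation; the analogue of Chua's Theorem 2.2). [cite: Chua2005RealZeros, Theorem 2.2] -/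
theorem norm_tsum_term_tail_le (hχ : χ ≠ 1) (hUq : ∑ k ∈ range q, partialSum χ (k + 1) = 0)
    {B : ℝ} (hU : ∀ N, N < q → ‖∑ k ∈ range N, partialSum χ (k + 1)‖ ≤ B) {σ : ℝ} (hσ : 0 < σ) :
    ‖∑' k : ℕ, term χ (k + q) (σ : ℂ)‖ ≤
      B * (((q + 1 : ℕ) : ℝ) ^ (-σ) - ((q + 1 + 1 : ℕ) : ℝ) ^ (-σ)) := by
  have hs : 0 < (σ : ℂ).re := by simpa using hσ
  have hsum : Summable fun k : ℕ ↦ term χ (k + q) (σ : ℂ) :=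
    (summable_nat_add_iff q).mpr (summable_term χ hχ hs)
  have ht := hsum.tendsto_sum_tsum_nat
  refine le_of_tendsto' ht.norm fun L ↦ ?_
  -- rewrite the partial sum in Abel form `∑ a_k w_k`
  have hterm : ∀ k, term χ (k + q) (σ : ℂ) = partialSum χ (k + 1) *
      ((((k + q + 1 : ℕ) : ℝ) ^ (-σ) - ((k + q + 1 + 1 : ℕ) : ℝ) ^ (-σ) : ℝ) : ℂ) := fun k ↦ by
    rw [term_ofReal, show k + q + 1 = (k + 1) + q by ring, partialSum_add_level χ hχ]
  simp only [hterm]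
  have h := norm_sum_mul_le_of_antitone (fun k ↦ partialSum χ (k + 1))
    (fun k ↦ ((k + q + 1 : ℕ) : ℝ) ^ (-σ) - ((k + q + 1 + 1 : ℕ) : ℝ) ^ (-σ))
    (B := B) L (fun N _ ↦ norm_sum_partialSum_le χ hχ hUq hU N)
    (fun k ↦ rpow_neg_sub_succ_nonneg (m := k + q + 1) (by omega) hσ.le) (fun k ↦ by
      simpa [show k + 1 + q + 1 = k + q + 1 + 1 by ring] using wt_succ_le hσ (k + q))
  simpa using h

/-- **The head.** `∑_{n<q} term χ n σ = ∑_{n ≤ q} χ(n) n^{-σ}` (finite Abel summation and `S(q) = 0`).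
[cite: MontgomeryVaughan2007, §1.3 Thm. 1.3] -/
private theorem sum_term_head (hχ : χ ≠ 1) (s : ℂ) :
    ∑ n ∈ range q, term χ n s = ∑ n ∈ range q, χ ((n + 1 : ℕ) : ZMod q) * ((n + 1 : ℕ) : ℂ) ^ (-s) := by
  have h := sum_apply_mul_cpow_eq χ s q
  have hq : partialSum χ q = 0 := by simpa using partialSum_add_level χ hχ 0
  rw [hq, zero_mul, zero_add] at h
  exact h.symm

/-- **The truncation bound** (this file's form of Chua's `L = L_0 + E_1`, Theorem 2.2): for `χ ≠ χ₀`
mod `q`, `∑_{K ≤ q} S(K) = 0`, `‖∑_{K ≤ N} S(K)‖ ≤ B` (`N < q`) and real `σ > 0`,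
`ℜ L(σ, χ) ≥ P(σ) − B · ((q+1)^{-σ} − (q+2)^{-σ})`. [cite: Chua2005RealZeros, Theorem 2.2] -/
theorem re_LFunction_ge_truncation (hχ : χ ≠ 1)
    (hUq : ∑ k ∈ range q, partialSum χ (k + 1) = 0)
    {B : ℝ} (hU : ∀ N, N < q → ‖∑ k ∈ range N, partialSum χ (k + 1)‖ ≤ B) {σ : ℝ} (hσ : 0 < σ) :
    (∑ n ∈ range q, (χ ((n + 1 : ℕ) : ZMod q)).re * ((n + 1 : ℕ) : ℝ) ^ (-σ)) -
        B * (((q + 1 : ℕ) : ℝ) ^ (-σ) - ((q + 1 + 1 : ℕ) : ℝ) ^ (-σ)) ≤ (χ.LFunction (σ : ℂ)).re := by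
  have hs : 0 < (σ : ℂ).re := by simpa using hσ
  have hsum := summable_term χ hχ hs
  rw [LFunction_eq_abelSum χ hχ hs, abelSum, ← hsum.sum_add_tsum_nat_add q, Complex.add_re,
    sum_term_head χ hχ]
  have hhead : (∑ n ∈ range q, χ ((n + 1 : ℕ) : ZMod q) * ((n + 1 : ℕ) : ℂ) ^ (-(σ : ℂ))).re =
      ∑ n ∈ range q, (χ ((n + 1 : ℕ) : ZMod q)).re * ((n + 1 : ℕ) : ℝ) ^ (-σ) := by
    rw [Complex.re_sum]
    refine Finset.sum_congr rfl fun n _ ↦ ?_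
    rw [show ((n + 1 : ℕ) : ℂ) = (((n + 1 : ℕ) : ℝ) : ℂ) by push_cast; rfl,
      show -(σ : ℂ) = ((-σ : ℝ) : ℂ) by push_cast; rfl, ← Complex.ofReal_cpow (by positivity),
      Complex.re_mul_ofReal]
  rw [hhead]
  have htail := norm_tsum_term_tail_le χ hχ hUq hU hσ
  have hre : -‖∑' k : ℕ, term χ (k + q) (σ : ℂ)‖ ≤ (∑' k : ℕ, term χ (k + q) (σ : ℂ)).re :=
    (abs_le.mp (Complex.abs_re_le_norm _)).1
  linarith

/-! ### The cell bound: controlling `∑ c_n n^{-s}` on `s ∈ [s₀, s₀ + h]` from data at `s₀` -/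

/-- **Cell bound.** With `A(N) = ∑_{n ≤ N} c_n n^{-s₀}`, for `0 ≤ u ≤ h`:
`∑_{n ≤ M} c_n n^{-(s₀+u)} ≥ A(M) M^{-u} − h ∑_{N<M} max(0, −A(N))/N` (Abel summation in the
variable `u`; `0 ≤ N^{-u} − (N+1)^{-u} ≤ u/N`). This replaces the mean-value step of Chua's ALGO 1.
[cite: Chua2005RealZeros, §2.2 Lemma 2.3] -/
theorem cell_bound (c : ℕ → ℝ) (M : ℕ) (s₀ : ℝ) {u h : ℝ} (hu0 : 0 ≤ u) (huh : u ≤ h) :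
    (∑ n ∈ range M, c n * ((n + 1 : ℕ) : ℝ) ^ (-s₀)) * ((M : ℕ) : ℝ) ^ (-u) -
        h * ∑ i ∈ range (M - 1),
          max 0 (-(∑ n ∈ range (i + 1), c n * ((n + 1 : ℕ) : ℝ) ^ (-s₀))) / ((i + 1 : ℕ) : ℝ)
      ≤ ∑ n ∈ range M, c n * ((n + 1 : ℕ) : ℝ) ^ (-(s₀ + u)) := by
  rcases Nat.eq_zero_or_pos M with rfl | hM
  · simp
  set g : ℕ → ℝ := fun n ↦ c n * ((n + 1 : ℕ) : ℝ) ^ (-s₀) with hg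
  set f : ℕ → ℝ := fun n ↦ ((n + 1 : ℕ) : ℝ) ^ (-u) with hf
  have hsplit : ∑ n ∈ range M, c n * ((n + 1 : ℕ) : ℝ) ^ (-(s₀ + u)) = ∑ n ∈ range M, f n • g n := by
    refine Finset.sum_congr rfl fun n _ ↦ ?_
    rw [hf, hg, smul_eq_mul, neg_add, Real.rpow_add (by positivity)]
    ring
  rw [hsplit, Finset.sum_range_by_parts f g M]
  have hfM : f (M - 1) = ((M : ℕ) : ℝ) ^ (-u) := by
    rw [hf]; push_cast; rw [Nat.cast_sub hM]; push_cast; ring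
  rw [hfM, smul_eq_mul, mul_comm]
  -- the correction terms
  have hterm : ∀ i ∈ range (M - 1),
      -(h * (max 0 (-(∑ n ∈ range (i + 1), g n)) / ((i + 1 : ℕ) : ℝ))) ≤
        -((f (i + 1) - f i) • ∑ n ∈ range (i + 1), g n) := by
    intro i _
    have hδ0 : 0 ≤ f i - f (i + 1) := by
      rw [hf]; exact rpow_neg_sub_succ_nonneg (by omega) hu0
    have hδ1 : f i - f (i + 1) ≤ h / ((i + 1 : ℕ) : ℝ) := by
      rw [hf]
      calc ((i + 1 : ℕ) : ℝ) ^ (-u) - ((i + 1 + 1 : ℕ) : ℝ) ^ (-u) ≤ u / ((i + 1 : ℕ) : ℝ) :=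
            rpow_neg_sub_succ_le' (by omega) hu0
        _ ≤ h / ((i + 1 : ℕ) : ℝ) := div_le_div_of_nonneg_right huh (by positivity)
    rw [smul_eq_mul, neg_le]
    set A := ∑ n ∈ range (i + 1), g n
    have hmax0 : 0 ≤ max 0 (-A) := le_max_left _ _
    have hmaxA : -A ≤ max 0 (-A) := le_max_right _ _
    have hi0 : (0 : ℝ) < ((i + 1 : ℕ) : ℝ) := by positivity
    calc -(-((f (i + 1) - f i) * A)) = (f i - f (i + 1)) * (-A) := by ring
      _ ≤ (f i - f (i + 1)) * max 0 (-A) := mul_le_mul_of_nonneg_left hmaxA hδ0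
      _ ≤ h / ((i + 1 : ℕ) : ℝ) * max 0 (-A) := mul_le_mul_of_nonneg_right hδ1 hmax0
      _ = h * (max 0 (-A) / ((i + 1 : ℕ) : ℝ)) := by ring
  have hsum := Finset.sum_le_sum hterm
  rw [Finset.sum_neg_distrib, Finset.sum_neg_distrib, ← Finset.mul_sum] at hsum
  linarith

/-! ### From `ℜ L > 0` on `[1/2, 1]` to no zero in `(0, 1)` (functional equation) -/

/-- For a PRIMITIVE character mod `q ≠ 1`: if `ℜ L(σ, χ) > 0` for `1/2 ≤ σ ≤ 1` then `L(σ, χ) ≠ 0`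
for every `0 < σ < 1` — zeros in `(0, 1/2)` reflect to `(1/2, 1)` (MV §10.1, tree
`LFunction_one_sub_conj_eq_zero`). [cite: MontgomeryVaughan2007, §10.1 (after Cor. 10.8)] -/
theorem lfunction_ne_zero_of_re_pos (hprim : χ.IsPrimitive) (hq : q ≠ 1)
    (hpos : ∀ σ : ℝ, 1 / 2 ≤ σ → σ ≤ 1 → 0 < (χ.LFunction (σ : ℂ)).re) :
    ∀ σ : ℝ, 0 < σ → σ < 1 → χ.LFunction (σ : ℂ) ≠ 0 := by
  intro σ h0 h1 hz
  by_cases hσ : 1 / 2 ≤ σ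
  · have := hpos σ hσ h1.le
    rw [hz, Complex.zero_re] at this
    exact lt_irrefl _ this
  · have href := LFunction_one_sub_conj_eq_zero hprim hq hz (by simpa using h0)
    rw [Complex.conj_ofReal, show (1 : ℂ) - (σ : ℂ) = ((1 - σ : ℝ) : ℂ) by push_cast; rfl] at href
    have := hpos (1 - σ) (by linarith) (by linarith)
    rw [href, Complex.zero_re] at this
    exact lt_irrefl _ this

/-- **Assembly.** `χ` primitive mod `q ≥ 7`, `χ ≠ χ₀`; second-order data over one period:
`∑_{K ≤ q} S(K) = 0` and `‖∑_{K ≤ N} S(K)‖ ≤ B` for `N < q`; an integer `r > 0` with `r² ≤ q + 1`; and the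
truncated series dominates the tail bound, `P(σ) > B/(2r(q+1))` for all `σ ∈ [1/2, 1]`. Then `L(σ, χ) ≠ 0`
for every `σ ∈ (0, 1)`. [cite: Chua2005RealZeros, §2.2 ALGO 1] -/
theorem lfunction_ne_zero_of_truncation (hprim : χ.IsPrimitive) (hχ : χ ≠ 1) (hq : 7 ≤ q)
    (hUq : ∑ k ∈ range q, partialSum χ (k + 1) = 0)
    {B : ℝ} (hU : ∀ N, N < q → ‖∑ k ∈ range N, partialSum χ (k + 1)‖ ≤ B)
    {r : ℕ} (hr : 0 < r) (hrq : r * r ≤ q + 1)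
    (hP : ∀ σ : ℝ, 1 / 2 ≤ σ → σ ≤ 1 → B / (2 * r * (q + 1 : ℕ)) <
      ∑ n ∈ range q, (χ ((n + 1 : ℕ) : ZMod q)).re * ((n + 1 : ℕ) : ℝ) ^ (-σ)) :
    ∀ σ : ℝ, 0 < σ → σ < 1 → χ.LFunction (σ : ℂ) ≠ 0 := by
  have hB : 0 ≤ B := le_trans (by simp) (hU 0 (by omega))
  refine lfunction_ne_zero_of_re_pos χ hprim (by omega) fun σ hσ hσ1 ↦ ?_
  have h1 := re_LFunction_ge_truncation χ hχ hUq hU (σ := σ) (by linarith)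
  have h2 : ((q + 1 : ℕ) : ℝ) ^ (-σ) - ((q + 1 + 1 : ℕ) : ℝ) ^ (-σ) ≤ 1 / (2 * r * (q + 1 : ℕ)) :=
    wt_le_of_half_le hσ (by omega) hr hrq
  have h3 : B * (((q + 1 : ℕ) : ℝ) ^ (-σ) - ((q + 1 + 1 : ℕ) : ℝ) ^ (-σ)) ≤ B / (2 * r * (q + 1 : ℕ)) := by
    calc B * (((q + 1 : ℕ) : ℝ) ^ (-σ) - ((q + 1 + 1 : ℕ) : ℝ) ^ (-σ))
        ≤ B * (1 / (2 * r * (q + 1 : ℕ))) := mul_le_mul_of_nonneg_left h2 hB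
      _ = B / (2 * r * (q + 1 : ℕ)) := by ring
  linarith [hP σ hσ hσ1]

end LTruncation

end Literature.NumberTheory.LFunctions
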